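import Mathlib
import Summits.Ventures.PercRepro2.SwOutCrossGenProd

/-!
# The bare junction: the bare fibre and its inequality (blind cell PercRepro2, night-4 g24,
2026-08-28; proofs/NIGHT4-G24.md §12)

With NO dropped component the cube of a junction is the cube of its u-arm bits alone; the
bare fibre `FibreIter.bare` (one point, no atoms, no leak, `theta = id`) is a `FibreIter`
and its inequality `ineq_bare` is the Harris–Kleitman inequality: the points of an up-set of
types form a LOWER set of red-arm sets, the points whose red atoms lie in `𝓔` an UPPER set, and
the blue atoms of a point are the red atoms of its complement.  With `FibreIter.steps` every
junction — any number of connected cross components and of single dropped vertices, in any order,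
possibly none — satisfies the inequality (`card_le_crossSteps`), the base case being the bare
junction.
-/

namespace Summit.Ventures.PercRepro2

namespace CrossArm

section Trivial

/-- **The bare fibre**: the junction without any dropped component. -/
def FibreIter.bare : FibreIter Unit Empty Unit where
  flip := id
  flip_flip := fun _ => rfl
  red := fun _ a => a.elim
  leakR := fun _ => false
  label := fun _ => ()
  BetterL := fun _ _ => True
  betterL_refl := fun _ => trivial
  theta := id
  theta_ok := fun _ _ => ⟨rfl, trivial, fun a => a.elim⟩
  theta_inj := fun _ _ _ _ _ => Subsingleton.elim _ _

variable {ι : Type*} [Fintype ι] [DecidableEq ι]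

/-- The red u-arms of a configuration. -/
def redSetT (s : Config ι) : Finset ι := Finset.univ.filter fun j => s j = true

/-- The configuration with the given red u-arms. -/
def cfgT (R : Finset ι) : Config ι := fun j => decide (j ∈ R)

/-- `cfgT` is a right inverse of `redSetT`. -/
lemma cfgT_redSetT (s : Config ι) : cfgT (redSetT s) = s := by
  funext j
  simp only [cfgT, redSetT, Finset.mem_filter, Finset.mem_univ, true_and]
  cases s j <;> simp

/-- `redSetT` is a right inverse of `cfgT`. -/
lemma redSetT_cfgT (R : Finset ι) : redSetT (cfgT R) = R := by
  ext j
  simp [redSetT, cfgT]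

/-- The flip of a configuration has the complementary red u-arms. -/
lemma cfgT_compl (R : Finset ι) : cfgT Rᶜ = flipAll (cfgT R) := by
  funext j
  simp only [cfgT, flipAll, Finset.mem_compl]
  by_cases h : j ∈ R <;> simp [h]

omit [Fintype ι] [DecidableEq ι] in
/-- The bare fibre never leaks. -/
lemma not_leakI_bare (q : PtG Unit ι) : ¬ LeakI FibreIter.bare q := by
  rintro (⟨-, h⟩ | ⟨-, h⟩) <;> exact Bool.noConfusion h

omit [Fintype ι] in
/-- The red atoms of the bare fibre are monotone in the red u-arms. -/
lemma ERI_bare_mono {R R' : Finset ι} (h : R ⊆ R') :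
    ERI FibreIter.bare (cfgT R, ()) ⊆ ERI FibreIter.bare (cfgT R', ()) := by
  rintro (j | (u | a)) ha
  · show cfgT R' j = true
    have ha' : cfgT R j = true := ha
    simp only [cfgT, decide_eq_true_eq] at ha' ⊢
    exact h ha'
  · obtain ⟨j, hj⟩ := (ha : redUG (cfgT R))
    refine ⟨j, ?_⟩
    simp only [cfgT, decide_eq_true_eq] at hj ⊢
    exact h hj
  · exact a.elim

open scoped Classical

omit [Fintype ι] [DecidableEq ι] in
/-- A point of the bare cube is determined by its configuration. -/
lemma eq_cfg_of_mem (x : PtG Unit ι) : x = (x.1, ()) := Prod.ext rfl (Subsingleton.elim _ _)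

/-- **The inequality of the bare junction** (Harris–Kleitman). -/
theorem ineq_bare : Ineq FibreIter.bare (ι := ι) := by
  intro 𝒯 𝓔 h𝒯 h𝓔
  -- the two families of red-arm sets
  set A : Finset ι → Prop := fun R => (cfgT R, ()) ∈ QI FibreIter.bare 𝒯 with hA
  set B : Finset ι → Prop := fun R => ERI FibreIter.bare (cfgT R, ()) ∈ 𝓔 with hB
  have hAlow : IsLowerSet ((Finset.univ.filter fun R => A R : Finset (Finset ι)) : Set (Finset ι)) := by
    intro R R' hle hR
    rw [Finset.mem_coe, Finset.mem_filter] at hR ⊢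
    refine ⟨Finset.mem_univ _, ?_⟩
    have hR := hR.2
    simp only [hA, mem_QI] at hR ⊢
    refine ⟨not_leakI_bare _, ?_⟩
    refine h𝒯 _ hR.2 _ ⟨fun j hj => ?_, trivial⟩
    have hj' : cfgT R j = false := hj
    show cfgT R' j = false
    simp only [cfgT, decide_eq_false_iff_not] at hj' ⊢
    exact fun h => hj' (hle h)
  have hBup : IsUpperSet ((Finset.univ.filter fun R => B R : Finset (Finset ι)) : Set (Finset ι)) := by
    intro R R' hle hR
    rw [Finset.mem_coe, Finset.mem_filter] at hR ⊢
    exact ⟨Finset.mem_univ _, h𝓔 (ERI_bare_mono hle) hR.2⟩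
  have hA'up : IsUpperSet ((Finset.univ.filter fun R => A Rᶜ : Finset (Finset ι)) : Set (Finset ι)) := by
    intro R R' hle hR
    rw [Finset.mem_coe, Finset.mem_filter] at hR ⊢
    refine ⟨Finset.mem_univ _, ?_⟩
    have := hAlow (Finset.compl_subset_compl.2 hle) (Finset.mem_coe.2 (Finset.mem_filter.2 ⟨Finset.mem_univ _, hR.2⟩))
    exact (Finset.mem_filter.1 (Finset.mem_coe.1 this)).2
  -- the left side is #(A ∩ B)
  have e1 : ((QI FibreIter.bare 𝒯).filter fun q => ERI FibreIter.bare q ∈ 𝓔).card =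
      ((Finset.univ.filter fun R => A R) ∩ (Finset.univ.filter fun R => B R)).card := by
    rw [← Finset.filter_and]
    refine Finset.card_bij' (fun q _ => redSetT q.1) (fun R _ => (cfgT R, ())) ?_ ?_ ?_ ?_
    · intro q hq
      rw [Finset.mem_filter] at hq
      rw [Finset.mem_filter]
      refine ⟨Finset.mem_univ _, ?_, ?_⟩
      · show (cfgT (redSetT q.1), ()) ∈ QI FibreIter.bare 𝒯
        rw [cfgT_redSetT, ← eq_cfg_of_mem]; exact hq.1
      · show ERI FibreIter.bare (cfgT (redSetT q.1), ()) ∈ 𝓔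
        rw [cfgT_redSetT, ← eq_cfg_of_mem]; exact hq.2
    · intro R hR
      rw [Finset.mem_filter] at hR
      rw [Finset.mem_filter]
      exact ⟨hR.2.1, hR.2.2⟩
    · intro q _
      rw [cfgT_redSetT, ← eq_cfg_of_mem]
    · intro R _
      exact redSetT_cfgT R
  -- the right side is #(A ∩ B ∘ compl) = #(A ∘ compl ∩ B)
  have e2 : ((QI FibreIter.bare 𝒯).filter fun q => EBI FibreIter.bare q ∈ 𝓔).card =
      ((Finset.univ.filter fun R => A Rᶜ) ∩ (Finset.univ.filter fun R => B R)).card := by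
    rw [← Finset.filter_and]
    refine Finset.card_bij' (fun q _ => (redSetT q.1)ᶜ) (fun R _ => (cfgT Rᶜ, ())) ?_ ?_ ?_ ?_
    · intro q hq
      rw [Finset.mem_filter] at hq
      rw [Finset.mem_filter]
      refine ⟨Finset.mem_univ _, ?_, ?_⟩
      · show (cfgT (redSetT q.1)ᶜᶜ, ()) ∈ QI FibreIter.bare 𝒯
        rw [compl_compl, cfgT_redSetT, ← eq_cfg_of_mem]; exact hq.1
      · show ERI FibreIter.bare (cfgT (redSetT q.1)ᶜ, ()) ∈ 𝓔
        rw [cfgT_compl, cfgT_redSetT]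
        exact hq.2
    · intro R hR
      rw [Finset.mem_filter] at hR
      rw [Finset.mem_filter]
      refine ⟨hR.2.1, ?_⟩
      show ERI FibreIter.bare (flipAll (cfgT Rᶜ), ()) ∈ 𝓔
      rw [← cfgT_compl, compl_compl]
      exact hR.2.2
    · intro q _
      rw [compl_compl, cfgT_redSetT, ← eq_cfg_of_mem]
    · intro R _
      rw [redSetT_cfgT, compl_compl]
  have hcardA : (Finset.univ.filter fun R => A Rᶜ).card = (Finset.univ.filter fun R => A R).card := by
    refine Finset.card_bij' (fun R _ => Rᶜ) (fun R _ => Rᶜ) ?_ ?_ ?_ ?_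
    · intro R hR
      rw [Finset.mem_filter] at hR ⊢
      exact ⟨Finset.mem_univ _, hR.2⟩
    · intro R hR
      rw [Finset.mem_filter] at hR ⊢
      exact ⟨Finset.mem_univ _, by rw [compl_compl]; exact hR.2⟩
    · intro R _; exact compl_compl R
    · intro R _; exact compl_compl R
  rw [e1, e2]
  have h1 := hAlow.card_inter_le_finset hBup
  have h2 := hA'up.le_card_inter_finset hBup
  rw [hcardA] at h2
  have hpos : 0 < 2 ^ Fintype.card ι := by positivity
  exact Nat.le_of_mul_le_mul_left (h1.trans h2) hpos

end Trivial

section Steps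

variable {ι : Type*} [Fintype ι] [DecidableEq ι] [Nonempty ι]

/-- **THE ABSTRACT THEOREM OF BOUNDARY (iv) AT ONE JUNCTION, FOR EVERY LIST OF STEPS FROM THE
BARE JUNCTION**: any number of connected cross components (`Step.comp (compKEE G hG)`) and of
single dropped vertices (`Step.bit`), in any order, possibly none. -/
theorem card_le_crossSteps (l : List Step.{0}) : Ineq (FibreIter.bare.steps l) (ι := ι) :=
  ineq_steps _ ineq_bare l

end Steps

end CrossArm

end Summit.Ventures.PercRepro2
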